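import Summits.HodgeConjecture.CorCM.D2Bridge.HcmS4Functoriality
import HarnessLib

/-!
# Δ2 BRIDGE — S4 in the SHAPE OF THE `HcmPieces` FIELDS: `resX (albK (phiStar φ α)) = geom (d_Liu (qOf φ)) (f_of φ)` from the
# neighbours' normal forms (S2: `phiStar` on pure tensors; S3: `resX`, `albK` are complexified pull-backs; S1: the transported eigenvector)

Cell pub-hodgecm2 (COR-CM), Δ2 BRIDGE, seat d2bridge-prove-4 (S4).  THEOREMS ONLY; hole-free (imports the S4 core
`CorCM/D2Bridge/HcmS4Functoriality`).  This is the last generic step before the pin: the three S4 fields of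
`HodgeCM.Literature.Theta.LiuAlbaneseModuleDatum.D2Bridge.HcmPieces` (v2, `CorCM/D2Bridge/HcmPieces.lean`) are `qOf := qOf`,
`f_of φ := (incl ≫ alb ≫ bc (fOf φ)) ≫ u` (resp. `(j ≫ bc (fOf φ)) ≫ u`), `geom_eq := ‹the law below›`, once the pin's `resX`, `albK`,
`phiStar` satisfy the displayed normal forms (which at the pin are `rfl` ∕ `LinearEquiv.ofBijective_apply` ∕ S2's `phiStarQHom_tmul`) and
S1's record `d_Liu q` carries `(α : (d_Liu q).α) = (q : ℂ) • α'` with prove-1's transport law `hu`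
(`CorCM/D2Bridge/HcmS1LiuCMRecord.lean`, `exists_liuCMRecord_of_cmDatum`, last conjunct).  Two architectures are served: (W) the whole
level — `resX` = restriction along `incl : P_Γ ⟶ X_{K,ℂ}`, `albK` = `(α_K)^*_ℂ` along `alb : X_{K,ℂ} ⟶ A_{K,ℂ}`; (C) the component —
`albK` = the Abel–Jacobi pull-back of `P_Γ` itself along `j : P_Γ ⟶ Alb(P_Γ)` (prove-3's `bijective_baseChange_pull_abelJacobi_pms`,
`CorCM/D2Bridge/HcmS3AlbaneseBetti.lean`) and `resX = id`, the morphism `Alb(P_Γ) ⟶ A_{K,ℂ}` being absorbed in `bc`; (J1) the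
tower in its RATIONAL FORM (prove-3's J STATEMENT, HOME/INBOX l. 10809): `AK = XK = ℂ ⊗ towerLevelQ Γ` abstract, `albK = refl`,
`resX = resQ ⊗ ℂ`, the J2 law `resQ ∘ phiStarQ K f = (transfer ≫ albOnComponent K 1 ≫ f_ℂ)^*` as the ONE hypothesis `hψ`.
HC_CM is NOT proved; «Δ2 BRIDGE CLOSED» is NOT claimed; no pointer ∕ count ∕ hM token.

## References
* [Liu2021] Y. Liu, *Fourier–Jacobi cycles and arithmetic relative trace formula*, Camb. J. Math. 9 (2021) = arXiv:2102.11518 — proof of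
  Thm. 4.18 (FJcycle.tex l. 2247–2253), Lem. 2.4 (1) (l. 1210–1228), Def. 2.3.
-/

set_option autoImplicit false

noncomputable section

open scoped TensorProduct
open CategoryTheory
open Literature.AlgebraicGeometry.Motives (SchemeOver bettiCohomology)
open Literature.AlgebraicGeometry.HodgeTheory.BettiUniverse (pull)

namespace Summit.HodgeConjecture.CorCM.D2Bridge

variable {P X B A A' : SchemeOver ℂ} {Hm : Type*} [AddCommGroup Hm]

/-- **S4 FIELDS, architecture (W) — whole level.**  Given the pin's maps `resX`, `albK`, `phiStar` in the NORMAL FORMS of S3∕S2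
(`resX` = `incl^*_ℂ`, `albK` = `alb^*_ℂ`, `phiStar (q ⊗ f)` = `q • (bc f)^*_ℂ`) and S1's transported eigenvector (`hu`), there are
`qOf`, `fOf` with `resX (albK (phiStar φ α₀)) = ((incl ≫ alb ≫ bc (fOf φ)) ≫ u)^*_ℂ ((qOf φ : ℂ) • α')` for every `φ ∈ ℚ ⊗_ℤ Hom` — the
field `geom_eq` of `HcmPieces` with `geom d f = f^*_ℂ α_d`, `α_{d_Liu q} = (q : ℂ) • α'`. [cite: Liu2021, proof of Thm. 4.18 (l. 2247–2253); Lem. 2.4 (1)] -/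
theorem exists_hcmPieces_S4_whole (incl : P ⟶ X) (alb : X ⟶ B) (bc : Hm → (B ⟶ A)) (u : A ⟶ A')
    (resX : ℂ ⊗[ℚ] bettiCohomology X 1 →ₗ[ℂ] ℂ ⊗[ℚ] bettiCohomology P 1)
    (albK : ℂ ⊗[ℚ] bettiCohomology B 1 ≃ₗ[ℂ] ℂ ⊗[ℚ] bettiCohomology X 1)
    (phiStar : ℚ ⊗[ℤ] Hm → (ℂ ⊗[ℚ] bettiCohomology A 1) →ₗ[ℂ] ℂ ⊗[ℚ] bettiCohomology B 1)
    (hresX : ∀ y, resX y = (pull incl 1).baseChange ℂ y)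
    (halbK : ∀ x, albK x = (pull alb 1).baseChange ℂ x)
    (hphi : ∀ (q : ℚ) (f : Hm) (c : ℂ ⊗[ℚ] bettiCohomology A 1), phiStar (q ⊗ₜ f) c = q • (pull (bc f) 1).baseChange ℂ c)
    {α₀ : ℂ ⊗[ℚ] bettiCohomology A 1} {α' : ℂ ⊗[ℚ] bettiCohomology A' 1}
    (hu : ∀ (Y : SchemeOver ℂ) (f : Y ⟶ A), (pull (f ≫ u) 1).baseChange ℂ α' = (pull f 1).baseChange ℂ α₀) :
    ∃ (qOf : ℚ ⊗[ℤ] Hm → ℚ) (fOf : ℚ ⊗[ℤ] Hm → Hm), ∀ φ : ℚ ⊗[ℤ] Hm,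
      resX (albK (phiStar φ α₀)) = (pull ((incl ≫ alb ≫ bc (fOf φ)) ≫ u) 1).baseChange ℂ ((qOf φ : ℂ) • α') := by
  choose qOf fOf h using fun φ : ℚ ⊗[ℤ] Hm => exists_eq_rat_tmul φ
  refine ⟨qOf, fOf, fun φ => ?_⟩
  rw [hresX, halbK]
  conv_lhs => rw [h φ, hphi]
  exact geom_eq_core_transport incl alb (bc (fOf φ)) u hu (qOf φ)

/-- **S4 FIELDS, architecture (C) — component.**  `albK` = the Abel–Jacobi pull-back of the component `P_Γ` itself along
`j : P_Γ ⟶ Alb(P_Γ)` and `resX = id`; the morphism `Alb(P_Γ) ⟶ A_{K,ℂ} ⟶ A_{μ,ℂ}` sits in `bc`.  Then there are `qOf`, `fOf` with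
`resX (albK (phiStar φ α₀)) = ((j ≫ bc (fOf φ)) ≫ u)^*_ℂ ((qOf φ : ℂ) • α')`. [cite: Liu2021, proof of Thm. 4.18 (l. 2247–2253); Lem. 2.4 (1)] -/
theorem exists_hcmPieces_S4_component (j : P ⟶ B) (bc : Hm → (B ⟶ A)) (u : A ⟶ A')
    (resX : ℂ ⊗[ℚ] bettiCohomology P 1 →ₗ[ℂ] ℂ ⊗[ℚ] bettiCohomology P 1)
    (albK : ℂ ⊗[ℚ] bettiCohomology B 1 ≃ₗ[ℂ] ℂ ⊗[ℚ] bettiCohomology P 1)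
    (phiStar : ℚ ⊗[ℤ] Hm → (ℂ ⊗[ℚ] bettiCohomology A 1) →ₗ[ℂ] ℂ ⊗[ℚ] bettiCohomology B 1)
    (hresX : ∀ y, resX y = y)
    (halbK : ∀ x, albK x = (pull j 1).baseChange ℂ x)
    (hphi : ∀ (q : ℚ) (f : Hm) (c : ℂ ⊗[ℚ] bettiCohomology A 1), phiStar (q ⊗ₜ f) c = q • (pull (bc f) 1).baseChange ℂ c)
    {α₀ : ℂ ⊗[ℚ] bettiCohomology A 1} {α' : ℂ ⊗[ℚ] bettiCohomology A' 1}
    (hu : ∀ (Y : SchemeOver ℂ) (f : Y ⟶ A), (pull (f ≫ u) 1).baseChange ℂ α' = (pull f 1).baseChange ℂ α₀) :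
    ∃ (qOf : ℚ ⊗[ℤ] Hm → ℚ) (fOf : ℚ ⊗[ℤ] Hm → Hm), ∀ φ : ℚ ⊗[ℤ] Hm,
      resX (albK (phiStar φ α₀)) = (pull ((j ≫ bc (fOf φ)) ≫ u) 1).baseChange ℂ ((qOf φ : ℂ) • α') := by
  choose qOf fOf h using fun φ : ℚ ⊗[ℤ] Hm => exists_eq_rat_tmul φ
  refine ⟨qOf, fOf, fun φ => ?_⟩
  rw [hresX, halbK]
  conv_lhs => rw [h φ, hphi]
  exact geom_eq_core₂_transport j (bc (fOf φ)) u hu (qOf φ)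

/-- **S4 FIELDS in S2's packaging `phiStar φ = (ψ φ) ⊗ ℂ`, architecture (W).**  As `exists_hcmPieces_S4_whole` with S2's field
`phiStar φ := (ψ φ).baseChange ℂ` literally (`ψ` = prove-2's `phiStarQHom K`, `ψ (q ⊗ f) = q • (bc f)^*` on RATIONAL classes).
[cite: Liu2021, proof of Thm. 4.18 (l. 2247–2253); Lem. 2.4 (1)] -/
theorem exists_hcmPieces_S4_whole_baseChange (incl : P ⟶ X) (alb : X ⟶ B) (bc : Hm → (B ⟶ A)) (u : A ⟶ A')
    (resX : ℂ ⊗[ℚ] bettiCohomology X 1 →ₗ[ℂ] ℂ ⊗[ℚ] bettiCohomology P 1)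
    (albK : ℂ ⊗[ℚ] bettiCohomology B 1 ≃ₗ[ℂ] ℂ ⊗[ℚ] bettiCohomology X 1)
    (ψ : ℚ ⊗[ℤ] Hm → (bettiCohomology A 1 →ₗ[ℚ] bettiCohomology B 1))
    (hresX : ∀ y, resX y = (pull incl 1).baseChange ℂ y)
    (halbK : ∀ x, albK x = (pull alb 1).baseChange ℂ x)
    (hψ : ∀ (q : ℚ) (f : Hm), ψ (q ⊗ₜ f) = q • pull (bc f) 1)
    {α₀ : ℂ ⊗[ℚ] bettiCohomology A 1} {α' : ℂ ⊗[ℚ] bettiCohomology A' 1}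
    (hu : ∀ (Y : SchemeOver ℂ) (f : Y ⟶ A), (pull (f ≫ u) 1).baseChange ℂ α' = (pull f 1).baseChange ℂ α₀) :
    ∃ (qOf : ℚ ⊗[ℤ] Hm → ℚ) (fOf : ℚ ⊗[ℤ] Hm → Hm), ∀ φ : ℚ ⊗[ℤ] Hm,
      resX (albK ((ψ φ).baseChange ℂ α₀)) = (pull ((incl ≫ alb ≫ bc (fOf φ)) ≫ u) 1).baseChange ℂ ((qOf φ : ℂ) • α') := by
  obtain ⟨qOf, fOf, h⟩ := exists_qOf_fOf_transport incl alb bc u ψ hψ hu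
  exact ⟨qOf, fOf, fun φ => by rw [hresX, halbK, h φ]⟩

/-- **S4 FIELDS in S2's packaging, architecture (C).** [cite: Liu2021, proof of Thm. 4.18 (l. 2247–2253); Lem. 2.4 (1)] -/
theorem exists_hcmPieces_S4_component_baseChange (j : P ⟶ B) (bc : Hm → (B ⟶ A)) (u : A ⟶ A')
    (resX : ℂ ⊗[ℚ] bettiCohomology P 1 →ₗ[ℂ] ℂ ⊗[ℚ] bettiCohomology P 1)
    (albK : ℂ ⊗[ℚ] bettiCohomology B 1 ≃ₗ[ℂ] ℂ ⊗[ℚ] bettiCohomology P 1)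
    (ψ : ℚ ⊗[ℤ] Hm → (bettiCohomology A 1 →ₗ[ℚ] bettiCohomology B 1))
    (hresX : ∀ y, resX y = y)
    (halbK : ∀ x, albK x = (pull j 1).baseChange ℂ x)
    (hψ : ∀ (q : ℚ) (f : Hm), ψ (q ⊗ₜ f) = q • pull (bc f) 1)
    {α₀ : ℂ ⊗[ℚ] bettiCohomology A 1} {α' : ℂ ⊗[ℚ] bettiCohomology A' 1}
    (hu : ∀ (Y : SchemeOver ℂ) (f : Y ⟶ A), (pull (f ≫ u) 1).baseChange ℂ α' = (pull f 1).baseChange ℂ α₀) :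
    ∃ (qOf : ℚ ⊗[ℤ] Hm → ℚ) (fOf : ℚ ⊗[ℤ] Hm → Hm), ∀ φ : ℚ ⊗[ℤ] Hm,
      resX (albK ((ψ φ).baseChange ℂ α₀)) = (pull ((j ≫ bc (fOf φ)) ≫ u) 1).baseChange ℂ ((qOf φ : ℂ) • α') := by
  choose qOf fOf h using fun φ : ℚ ⊗[ℤ] Hm => exists_eq_rat_tmul φ
  refine ⟨qOf, fOf, fun φ => ?_⟩
  rw [hresX, halbK]
  conv_lhs => rw [h φ, hψ, LinearMap.baseChange_smul, LinearMap.smul_apply]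
  exact geom_eq_core₂_transport j (bc (fOf φ)) u hu (qOf φ)

/-! ## Architecture (J1): the tower in its RATIONAL FORM — `AK = XK = ℂ ⊗ towerLevelQ Γ` is an abstract `ℚ`-module, `albK = refl`,
`resX = resQ ⊗ ℂ`, and the J2 law gives the composite `resQ ∘ phiStarQ K f` as ONE pull-back along `P_Γ → A_{K,ℂ} → A_{μ,ℂ}` -/

/-- A rational factor through a complexified pull-back, then S1's transport: `q • g^*_ℂ α₀ = (g ≫ u)^*_ℂ ((q : ℂ) • α')`.
[cite: Liu2021, proof of Thm. 4.18 (l. 2247–2253)] -/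
theorem rat_smul_baseChange_pull_transport (g : P ⟶ A) (u : A ⟶ A')
    {α₀ : ℂ ⊗[ℚ] bettiCohomology A 1} {α' : ℂ ⊗[ℚ] bettiCohomology A' 1}
    (hu : ∀ (Y : SchemeOver ℂ) (f : Y ⟶ A), (pull (f ≫ u) 1).baseChange ℂ α' = (pull f 1).baseChange ℂ α₀) (q : ℚ) :
    q • (pull g 1).baseChange ℂ α₀ = (pull (g ≫ u) 1).baseChange ℂ ((q : ℂ) • α') := by
  rw [LinearMap.map_smul, hu, ratCast_smul_eq_rat_smul]

/-- **S4 FIELDS, architecture (J1) — rational tower form (d2bridge-prove-3's J STATEMENT, HOME/INBOX l. 10809).**  Here `AK = XK` is the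
complexification of an ABSTRACT `ℚ`-module `AKQ` (the model's `towerLevelQ Γ ⊆ Π_h H¹(P_{Γ_h}; ℚ)`), `albK = refl`, `resX = resQ ⊗ ℂ` for a
`ℚ`-linear `resQ : AKQ → H¹(P_Γ; ℚ)` (evaluation at the identity component, then the transfer pull-back), S2's `phiStar φ = (ψ φ) ⊗ ℂ`, and
the J2 law (component Albanese morphisms) supplies, for ONE morphism `f`, the composite as ONE pull-back:
`resQ ∘ ψ (q ⊗ f) = q • (jf f)^*` with `jf f : P_Γ ⟶ A_{μ,ℂ}` (= transfer ≫ `albOnComponent K 1` ≫ `f_ℂ`).  Then there are `qOf`, `fOf`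
with `resX (albK (phiStar φ α₀)) = ((jf (fOf φ)) ≫ u)^*_ℂ ((qOf φ : ℂ) • α')` for EVERY `φ` — the `HcmPieces` fields with
`f_of φ := jf (fOf φ) ≫ u`. [cite: Liu2021, proof of Thm. 4.18 (l. 2247–2253); Lem. 2.4 (1); Def. 2.3] -/
theorem exists_hcmPieces_S4_rationalTower {AKQ : Type*} [AddCommGroup AKQ] [Module ℚ AKQ]
    (ψ : ℚ ⊗[ℤ] Hm → (bettiCohomology A 1 →ₗ[ℚ] AKQ)) (resQ : AKQ →ₗ[ℚ] bettiCohomology P 1)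
    (jf : Hm → (P ⟶ A)) (u : A ⟶ A')
    (albK : ℂ ⊗[ℚ] AKQ ≃ₗ[ℂ] ℂ ⊗[ℚ] AKQ) (halbK : ∀ x, albK x = x)
    (hψ : ∀ (q : ℚ) (f : Hm), resQ ∘ₗ ψ (q ⊗ₜ f) = q • pull (jf f) 1)
    {α₀ : ℂ ⊗[ℚ] bettiCohomology A 1} {α' : ℂ ⊗[ℚ] bettiCohomology A' 1}
    (hu : ∀ (Y : SchemeOver ℂ) (f : Y ⟶ A), (pull (f ≫ u) 1).baseChange ℂ α' = (pull f 1).baseChange ℂ α₀) :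
    ∃ (qOf : ℚ ⊗[ℤ] Hm → ℚ) (fOf : ℚ ⊗[ℤ] Hm → Hm), ∀ φ : ℚ ⊗[ℤ] Hm,
      (resQ.baseChange ℂ) (albK ((ψ φ).baseChange ℂ α₀)) = (pull (jf (fOf φ) ≫ u) 1).baseChange ℂ ((qOf φ : ℂ) • α') := by
  choose qOf fOf h using fun φ : ℚ ⊗[ℤ] Hm => exists_eq_rat_tmul φ
  refine ⟨qOf, fOf, fun φ => ?_⟩
  rw [halbK, ← LinearMap.comp_apply, ← LinearMap.baseChange_comp]
  conv_lhs => rw [h φ, hψ, LinearMap.baseChange_smul, LinearMap.smul_apply]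
  exact rat_smul_baseChange_pull_transport (jf (fOf φ)) u hu (qOf φ)

/-- **S4 FIELDS, architecture (J1), untransported eigenvector** (the record's variety IS `A_{μ,ℂ}`, `α_{d_q} = q • α`): `qOf`, `fOf` with
`resX (albK (phiStar φ α)) = (jf (fOf φ))^*_ℂ (qOf φ • α)`. [cite: Liu2021, proof of Thm. 4.18 (l. 2247–2253); Lem. 2.4 (1)] -/
theorem exists_hcmPieces_S4_rationalTower' {AKQ : Type*} [AddCommGroup AKQ] [Module ℚ AKQ]
    (ψ : ℚ ⊗[ℤ] Hm → (bettiCohomology A 1 →ₗ[ℚ] AKQ)) (resQ : AKQ →ₗ[ℚ] bettiCohomology P 1)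
    (jf : Hm → (P ⟶ A))
    (albK : ℂ ⊗[ℚ] AKQ ≃ₗ[ℂ] ℂ ⊗[ℚ] AKQ) (halbK : ∀ x, albK x = x)
    (hψ : ∀ (q : ℚ) (f : Hm), resQ ∘ₗ ψ (q ⊗ₜ f) = q • pull (jf f) 1)
    (α : ℂ ⊗[ℚ] bettiCohomology A 1) :
    ∃ (qOf : ℚ ⊗[ℤ] Hm → ℚ) (fOf : ℚ ⊗[ℤ] Hm → Hm), ∀ φ : ℚ ⊗[ℤ] Hm,
      (resQ.baseChange ℂ) (albK ((ψ φ).baseChange ℂ α)) = (pull (jf (fOf φ)) 1).baseChange ℂ (qOf φ • α) := by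
  choose qOf fOf h using fun φ : ℚ ⊗[ℤ] Hm => exists_eq_rat_tmul φ
  refine ⟨qOf, fOf, fun φ => ?_⟩
  rw [halbK, ← LinearMap.comp_apply, ← LinearMap.baseChange_comp]
  conv_lhs => rw [h φ, hψ, LinearMap.baseChange_smul, LinearMap.smul_apply]
  exact rat_smul_baseChange_pull (jf (fOf φ)) 1 (qOf φ) α

/-! ## The same with EXPLICIT choice functions (the form the pin's structure fields consume: `qOf φ := (exists_eq_rat_tmul φ).choose`,
`fOf φ := (exists_eq_rat_tmul φ).choose_spec.choose`, `hrepr φ := (exists_eq_rat_tmul φ).choose_spec.choose_spec`) -/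

/-- **S4 LAW for given choice functions, architecture (J1).**  For ANY `qOf`, `fOf` representing every `φ` as `qOf φ ⊗ fOf φ` (e.g. the
`choose` of `exists_eq_rat_tmul`), the `HcmPieces` law `geom_eq` holds with `f_of φ := jf (fOf φ) ≫ u`:
`resX (albK (phiStar φ α₀)) = (jf (fOf φ) ≫ u)^*_ℂ ((qOf φ : ℂ) • α')`. [cite: Liu2021, proof of Thm. 4.18 (l. 2247–2253); Lem. 2.4 (1)] -/
theorem hcmPieces_S4_rationalTower_of_repr {AKQ : Type*} [AddCommGroup AKQ] [Module ℚ AKQ]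
    (ψ : ℚ ⊗[ℤ] Hm → (bettiCohomology A 1 →ₗ[ℚ] AKQ)) (resQ : AKQ →ₗ[ℚ] bettiCohomology P 1)
    (jf : Hm → (P ⟶ A)) (u : A ⟶ A')
    (albK : ℂ ⊗[ℚ] AKQ ≃ₗ[ℂ] ℂ ⊗[ℚ] AKQ) (halbK : ∀ x, albK x = x)
    (hψ : ∀ (q : ℚ) (f : Hm), resQ ∘ₗ ψ (q ⊗ₜ f) = q • pull (jf f) 1)
    {α₀ : ℂ ⊗[ℚ] bettiCohomology A 1} {α' : ℂ ⊗[ℚ] bettiCohomology A' 1}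
    (hu : ∀ (Y : SchemeOver ℂ) (f : Y ⟶ A), (pull (f ≫ u) 1).baseChange ℂ α' = (pull f 1).baseChange ℂ α₀)
    (qOf : ℚ ⊗[ℤ] Hm → ℚ) (fOf : ℚ ⊗[ℤ] Hm → Hm) (hrepr : ∀ φ, φ = qOf φ ⊗ₜ fOf φ) (φ : ℚ ⊗[ℤ] Hm) :
    (resQ.baseChange ℂ) (albK ((ψ φ).baseChange ℂ α₀)) = (pull (jf (fOf φ) ≫ u) 1).baseChange ℂ ((qOf φ : ℂ) • α') := by
  rw [halbK, ← LinearMap.comp_apply, ← LinearMap.baseChange_comp]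
  conv_lhs => rw [hrepr φ, hψ, LinearMap.baseChange_smul, LinearMap.smul_apply]
  exact rat_smul_baseChange_pull_transport (jf (fOf φ)) u hu (qOf φ)

/-- **S4 LAW for given choice functions, architecture (W).**  `resX (albK (phiStar φ α₀)) = ((incl ≫ alb ≫ bc (fOf φ)) ≫ u)^*_ℂ ((qOf φ : ℂ) • α')`
for any representing pair `qOf`, `fOf`. [cite: Liu2021, proof of Thm. 4.18 (l. 2247–2253); Lem. 2.4 (1)] -/
theorem hcmPieces_S4_whole_of_repr (incl : P ⟶ X) (alb : X ⟶ B) (bc : Hm → (B ⟶ A)) (u : A ⟶ A')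
    (resX : ℂ ⊗[ℚ] bettiCohomology X 1 →ₗ[ℂ] ℂ ⊗[ℚ] bettiCohomology P 1)
    (albK : ℂ ⊗[ℚ] bettiCohomology B 1 ≃ₗ[ℂ] ℂ ⊗[ℚ] bettiCohomology X 1)
    (phiStar : ℚ ⊗[ℤ] Hm → (ℂ ⊗[ℚ] bettiCohomology A 1) →ₗ[ℂ] ℂ ⊗[ℚ] bettiCohomology B 1)
    (hresX : ∀ y, resX y = (pull incl 1).baseChange ℂ y)
    (halbK : ∀ x, albK x = (pull alb 1).baseChange ℂ x)
    (hphi : ∀ (q : ℚ) (f : Hm) (c : ℂ ⊗[ℚ] bettiCohomology A 1), phiStar (q ⊗ₜ f) c = q • (pull (bc f) 1).baseChange ℂ c)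
    {α₀ : ℂ ⊗[ℚ] bettiCohomology A 1} {α' : ℂ ⊗[ℚ] bettiCohomology A' 1}
    (hu : ∀ (Y : SchemeOver ℂ) (f : Y ⟶ A), (pull (f ≫ u) 1).baseChange ℂ α' = (pull f 1).baseChange ℂ α₀)
    (qOf : ℚ ⊗[ℤ] Hm → ℚ) (fOf : ℚ ⊗[ℤ] Hm → Hm) (hrepr : ∀ φ, φ = qOf φ ⊗ₜ fOf φ) (φ : ℚ ⊗[ℤ] Hm) :
    resX (albK (phiStar φ α₀)) = (pull ((incl ≫ alb ≫ bc (fOf φ)) ≫ u) 1).baseChange ℂ ((qOf φ : ℂ) • α') := by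
  rw [hresX, halbK]
  conv_lhs => rw [hrepr φ, hphi]
  exact geom_eq_core_transport incl alb (bc (fOf φ)) u hu (qOf φ)

end Summit.HodgeConjecture.CorCM.D2Bridge

end
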